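import Summits.NavierStokesRegularity.NavierStokesRegularity.Theorems.AngularGalerkinLadderLimitTransferOfRemainder
import Literature.Analysis.FluidPDE.TypeIForcedOseenMild

/-!
# Route `AngularGalerkinLadder` · K3 `LimitTransfer` (item 19961) — CLOSED

Cell `ns-blowup`, seat `ns-blowup-lit` (g14, hA′ holder of record by DIRECTOR-NS g6 #18 (2); decision (γ)
of plan g21, STATUS l.7132); `--workitem stmt-NavierStokesRegularity-19961`.
LABEL: KERNEL. WHAT THIS IS NOT: not a statement about Navier–Stokes regularity or blow-up — it proves
the typed parent crux `Theses.AngularGalerkinLadder.LimitTransfer` (limits of window profiles of the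
angular Galerkin ladder with vanishing defect are non-trivial Type-I rotated-DSS ancient mild solutions).

## Content

`angularGalerkinLadder_limitTransfer : Theses.AngularGalerkinLadder.LimitTransfer` — the tree reduction
`angularGalerkinLadder_limitTransfer_of_remainder'` (lean g11, p481922 + p482639: K3 follows from ONE
analytic brick hA′, the forced Oseen-mild remainder bound for Type-I classical fields with a defect
force of scale-invariant weight) applied to the Literature theorem
`Literature.Analysis.FluidPDE.forcedOseenMild_remainder_typeI` (lit g14, p492811,
`Literature/Analysis/FluidPDE/TypeIForcedOseenMild.lean`: Koch–Nadirashvili–Seregin–Šverák 2009,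
Lemma 3.1 / Remark 3.1 with §4 (i) (4.3)–(4.5) and the last paragraph of the proof of Thm. 6.1 —
pressure-free curl-pair duality `ClassicalCurlPairDuality.lean` p486985, the Oseen-tensor force Duhamel
term `OseenTensorForceDuhamel.lean` p489044/p491721, Liouville for the `div`–`curl` system and the Type-I
decay bounding the drift constant). hA′ is that theorem up to the order of its binders.

References: [cite: KochNadirashviliSereginSverak2009, Lemma 3.1 / Remark 3.1, §4 (i), Lemma 6.1, Prop. 4.1, proof of Thm. 6.1 (arXiv:0709.3599)];
[cite: ChaeWolf2017, Def. 1.1].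
-/

set_option linter.dupNamespace false

namespace Summit.NavierStokesRegularity.NavierStokesRegularity.Theorems

open Set

/-- **K3 `LimitTransfer` of the angular Galerkin ladder route**: limits of window profiles with
vanishing defect are non-trivial Type-I rotated-DSS ancient mild solutions — from the forced
Oseen-mild remainder bound of Type-I classical fields (KNSS 2009, Lemma 3.1 / Remark 3.1, §4 (i),
proof of Thm. 6.1) through `angularGalerkinLadder_limitTransfer_of_remainder'` (KNSS Lemma 6.1,
Prop. 4.1; Chae–Wolf Def. 1.1).
[cite: KochNadirashviliSereginSverak2009, Lemma 3.1 / Remark 3.1, Lemma 6.1, Prop. 4.1 (arXiv:0709.3599)] -/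
theorem angularGalerkinLadder_limitTransfer :
    Summit.NavierStokesRegularity.NavierStokesRegularity.Theses.AngularGalerkinLadder.LimitTransfer :=
  angularGalerkinLadder_limitTransfer_of_remainder' fun C₀ => by
    obtain ⟨Φ, K, hΦm, hΦ0, h⟩ := Literature.Analysis.FluidPDE.forcedOseenMild_remainder_typeI
    exact ⟨Φ, K, hΦm, hΦ0, fun ε u p d hcl hI hd _ => h hcl hI hd⟩

end Summit.NavierStokesRegularity.NavierStokesRegularity.Theorems
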